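import Summits.CriticalPhenomena.PercolationContinuityZ3.Theorems.PercNearOneGluingNoHeavyLowerTailSahiTransportJRMeasure

/-!
# `NoHeavyLowerTail` (crux stmt-CriticalPhenomena-4575), Sahi / Kahn positivity: parameter-free transport certificates — SOUNDNESS (III), the rows

Support file (cell `prim-l12`, seat P3, gen 5; `--supports stmt-CriticalPhenomena-4575`).  No `sorry`, no named facts, standard axioms.
Part of the SOUNDNESS of the parameter-free transport-certificate check `SahiTransportJR.checkTab` (`…SahiTransportJRTables`): if the digit test of
every capacity row and every (TC) row of a coefficient table `ct` for the pattern event with bitmask `M` passes, then at EVERY parameter vector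
`q ∈ [0,1]^m` the scaled measure `σ_q(T) = (1/DEN)·Σ_{η ∉ H ∋ ζ} ct[η][ζ][code T]·w_q(η)w_q(ζ)` satisfies (o), (a), (TC) of the reduced certificate,
hence (Strassen) a `SahiTransportCert.TransportCert` exists and Kahn's Conjecture 5 / Sahi's `C₃` holds for that junta first slot with the other
two slots arbitrary (`…SahiTransportCert.sahiE_three_nonneg_of_transportCert`).  Chain: `…JRDict` (dictionary `Set (Fin m)` ↔ bitmasks for
general `m`, structural facts of a table) → `…JRMeasure` (the scaled measure: mass, support, the stochastic-order condition (o)) → `…JRRows`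
(capacity and (TC) rows: certificate numbers = `cubicZ` of explicit term families, digit test ⇒ row inequality) → `…JRSound` (the certificate and
`sahiE_three_nonneg_of_checkTab`). [this work]

This file: the certificate numbers `aZ` (capacity rows) and `tcZ` ((TC) rows) of `…SahiTransportJRTables` are the `cubicZ` of explicit signed
families of cubic bitmask terms (`aZ_eq_cubicZ`, `tcZ_eq_cubicZ`, with the caches `prodTab`, `krT(full)`, `krT(D)` evaluated), their coefficient
budgets are `≤ BND m`, and a passing digit test gives `σ(T) ≤ (2−θ)w(T)` (`capacity_of_rowOK`) resp. `Σ_T σ(T)1_{𝒳∩𝒵}(T) ≤ tcR` (`tc_of_rowOK`).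
-/

noncomputable section

open scoped Classical

namespace Summit.CriticalPhenomena.PercolationContinuityZ3.Theorems.SahiTransportJR

open Finset SahiHittingSlot SahiTransportCert SahiC3Cube SahiTransportCheck OneCutCert CovTransferCert Literature.Combinatorics.Sahi2008
open Literature.Probability.Percolation (DeterminedBy)
open Literature.Probability.Percolation.BHK2006 (weight ind_inter)
open Literature.Probability.Percolation.DecisionTree (ind ind_of_mem ind_of_not_mem ind_nonneg)

variable {m : ℕ}

/-! #### Capacity rows -/

/-- The cache of singleton products. [this work] -/
theorem get2_prodTab (σ : ℕ) {η ζ : ℕ} (hη : η < 2 ^ m) (hζ : ζ < 2 ^ m) :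
    get2 (prodTab σ m) η ζ = (krT σ m (2 ^ η) : ℤ) * (krT σ m (2 ^ ζ) : ℤ) * (krT σ m (fullN m) : ℤ) := by
  unfold get2 prodTab
  simp only [List.getD_eq_getElem?_getD, List.getElem?_map, List.getElem?_range hη, List.getElem?_range hζ, Option.map_some,
    Option.getD_some]

/-- `rhoZ` with the true cache, as an indicator double sum. [this work] -/
theorem rhoZ_eq (σ M : ℕ) (ct : Tab) (K : ℕ) :
    rhoZ m M ct (prodTab σ m) K = ∑ η ∈ Finset.range (2 ^ m), ∑ ζ ∈ Finset.range (2 ^ m),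
      if M.testBit η = false ∧ M.testBit ζ = true then
        massK m M ct K η ζ * ((krT σ m (2 ^ η) : ℤ) * (krT σ m (2 ^ ζ) : ℤ) * (krT σ m (fullN m) : ℤ)) else 0 := by
  unfold rhoZ
  rw [sum_pts]
  refine Finset.sum_congr rfl fun η hη => ?_
  have hη' := Finset.mem_range.1 hη
  rw [testBit_cpl hη']
  by_cases hD : M.testBit η = false
  · rw [if_pos (by rw [hD]; rfl), sum_pts]
    refine Finset.sum_congr rfl fun ζ hζ => ?_
    by_cases hH : M.testBit ζ = true
    · rw [if_pos hH, if_pos ⟨hD, hH⟩, get2_prodTab σ hη' (Finset.mem_range.1 hζ)]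
    · rw [if_neg hH, if_neg (fun h => hH h.2)]
  · have hD' : M.testBit η = true := by cases hb : M.testBit η <;> simp_all
    rw [if_neg (by rw [hD']; decide)]
    symm; exact Finset.sum_eq_zero fun ζ _ => if_neg (fun h => hD h.1)

/-- Index type of the capacity rows: two head terms and the `(η, ζ)` terms. [this work] -/
abbrev JA (m : ℕ) := Fin 2 ⊕ (Fin (2 ^ m) × Fin (2 ^ m))

/-- Signs/coefficients of a capacity row. [this work] -/
def sA (m M : ℕ) (ct : Tab) (t : ℕ) : JA m → ℤ
  | Sum.inl _ => DEN
  | Sum.inr p => if M.testBit p.1 = false ∧ M.testBit p.2 = true then -massK m M ct (2 ^ t) p.1 p.2 else 0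

/-- First tables of a capacity row. [this work] -/
def a1 (m M : ℕ) : JA m → ℕ
  | Sum.inl j => if j = 0 then fullN m else cpl m M
  | Sum.inr p => 2 ^ (p.1 : ℕ)

/-- Second tables of a capacity row. [this work] -/
def a2 (m : ℕ) : JA m → ℕ
  | Sum.inl _ => fullN m
  | Sum.inr p => 2 ^ (p.2 : ℕ)

/-- Third tables of a capacity row. [this work] -/
def a3 (m t : ℕ) : JA m → ℕ
  | Sum.inl _ => 2 ^ t
  | Sum.inr _ => fullN m

/-- The certificate number of a capacity row is the `cubicZ` of its term family. [this work] -/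
theorem aZ_eq_cubicZ (σ M : ℕ) (ct : Tab) (t : ℕ) :
    aZ σ m M ct (prodTab σ m) (krT σ m (fullN m)) (krT σ m (cpl m M)) t =
      cubicZ (2 ^ σ) (sA m M ct t) (fun j => tabZ m (a1 m M j)) (fun j => tabZ m (a2 m j)) (fun j => tabZ m (a3 m t j)) := by
  unfold aZ cubicZ
  rw [Fintype.sum_sum_type, Fin.sum_univ_two, Fintype.sum_prod_type, rhoZ_eq]
  simp only [sA, a1, a2, a3, if_true, show (1 : Fin 2) ≠ 0 from by decide, if_false, ← krT_eq]
  rw [Fin.sum_univ_eq_sum_range (fun η => ∑ ζ : Fin (2 ^ m),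
      (if M.testBit η = false ∧ M.testBit (ζ : ℕ) = true then -massK m M ct (2 ^ t) η ζ else 0) *
        ((krT σ m (2 ^ η) : ℤ) * (krT σ m (2 ^ (ζ : ℕ)) : ℤ) * (krT σ m (fullN m) : ℤ))) (2 ^ m)]
  have hin : ∀ η : ℕ, (∑ ζ : Fin (2 ^ m), (if M.testBit η = false ∧ M.testBit (ζ : ℕ) = true then -massK m M ct (2 ^ t) η ζ else 0) *
        ((krT σ m (2 ^ η) : ℤ) * (krT σ m (2 ^ (ζ : ℕ)) : ℤ) * (krT σ m (fullN m) : ℤ))) =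
      ∑ ζ ∈ Finset.range (2 ^ m), (if M.testBit η = false ∧ M.testBit ζ = true then -massK m M ct (2 ^ t) η ζ else 0) *
        ((krT σ m (2 ^ η) : ℤ) * (krT σ m (2 ^ ζ) : ℤ) * (krT σ m (fullN m) : ℤ)) := fun η =>
    Fin.sum_univ_eq_sum_range (fun ζ => (if M.testBit η = false ∧ M.testBit ζ = true then -massK m M ct (2 ^ t) η ζ else 0) *
        ((krT σ m (2 ^ η) : ℤ) * (krT σ m (2 ^ ζ) : ℤ) * (krT σ m (fullN m) : ℤ))) (2 ^ m)
  simp only [hin]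
  have hneg : ∀ η ζ : ℕ, (if M.testBit η = false ∧ M.testBit ζ = true then -massK m M ct (2 ^ t) η ζ else 0) *
      ((krT σ m (2 ^ η) : ℤ) * (krT σ m (2 ^ ζ) : ℤ) * (krT σ m (fullN m) : ℤ)) =
      -(if M.testBit η = false ∧ M.testBit ζ = true then massK m M ct (2 ^ t) η ζ *
        ((krT σ m (2 ^ η) : ℤ) * (krT σ m (2 ^ ζ) : ℤ) * (krT σ m (fullN m) : ℤ)) else 0) := by
    intro η ζ; split_ifs <;> ring
  simp only [hneg, Finset.sum_neg_distrib]
  ring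

/-- The coefficient budget of a capacity row. [this work] -/
theorem abs_sA_le {M : ℕ} {ct : Tab} (hf : TabFacts m M ct) (t : ℕ) : (∑ j, |sA m M ct t j|) ≤ (BND m : ℤ) := by
  rw [Fintype.sum_sum_type, Fin.sum_univ_two, Fintype.sum_prod_type]
  have h1 : ∀ η ζ : Fin (2 ^ m), |sA m M ct t (Sum.inr (η, ζ))| ≤ DEN := by
    intro η ζ
    simp only [sA]
    split_ifs with hc
    · rw [abs_neg]
      have hb := massK_bounds hf (2 ^ t) η.2 hc.1 ζ.2 hc.2
      rw [abs_of_nonneg hb.1]; exact hb.2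
    · simp [DEN]
  have h2 : (∑ η : Fin (2 ^ m), ∑ ζ : Fin (2 ^ m), |sA m M ct t (Sum.inr (η, ζ))|) ≤ (2 ^ m * (2 ^ m * DEN) : ℤ) := by
    calc (∑ η : Fin (2 ^ m), ∑ ζ : Fin (2 ^ m), |sA m M ct t (Sum.inr (η, ζ))|)
        ≤ ∑ η : Fin (2 ^ m), ∑ ζ : Fin (2 ^ m), (DEN : ℤ) := Finset.sum_le_sum fun η _ => Finset.sum_le_sum fun ζ _ => h1 η ζ
      _ = 2 ^ m * (2 ^ m * DEN) := by simp
  have h0 : |sA m M ct t (Sum.inl 0)| = DEN := by simp [sA]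
  have h0' : |sA m M ct t (Sum.inl 1)| = DEN := by simp [sA]
  rw [h0, h0']
  have h4 : (4 : ℤ) ^ m = 2 ^ m * 2 ^ m := by rw [← mul_pow]; norm_num
  have h5 : (BND m : ℤ) = DEN * (8 + 2 ^ m * 2 ^ m) := by unfold BND; push_cast; rw [h4]
  rw [h5]
  nlinarith [h2, show (0 : ℤ) ≤ DEN from by simp [DEN], show (0:ℤ) ≤ 2 ^ m * 2 ^ m from by positivity]

/-- `DEN·σ(T)` as a double sum over `Fin (2^m) × Fin (2^m)`. [this work] -/
theorem DEN_mul_sg (M : ℕ) (ct : Tab) (q : Fin m → unitInterval) (T : Set (Fin m)) :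
    (DEN : ℝ) * sg m M ct q T = ∑ η : Fin (2 ^ m), ∑ ζ : Fin (2 ^ m),
      if M.testBit (η : ℕ) = false ∧ M.testBit (ζ : ℕ) = true then
        (get3 ct η ζ (code T) : ℝ) * (mlM m (2 ^ (η : ℕ)) (xq q) * mlM m (2 ^ (ζ : ℕ)) (xq q)) else 0 := by
  unfold sg
  rw [mul_div_cancel₀ _ DEN_pos.ne']
  rw [Fin.sum_univ_eq_sum_range (fun η => ∑ ζ : Fin (2 ^ m),
      if M.testBit η = false ∧ M.testBit (ζ : ℕ) = true then
        (get3 ct η ζ (code T) : ℝ) * (mlM m (2 ^ η) (xq q) * mlM m (2 ^ (ζ : ℕ)) (xq q)) else 0) (2 ^ m)]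
  refine Finset.sum_congr rfl fun η _ => ?_
  exact (Fin.sum_univ_eq_sum_range (fun ζ => if M.testBit η = false ∧ M.testBit ζ = true then
        (get3 ct η ζ (code T) : ℝ) * (mlM m (2 ^ η) (xq q) * mlM m (2 ^ ζ) (xq q)) else 0) (2 ^ m)).symm

/-- `massK` at a point mask is the table entry. [this work] -/
theorem massK_pow {M : ℕ} {ct : Tab} (hf : TabFacts m M ct) {t η ζ : ℕ} (ht : t < 2 ^ m) (hη : η < 2 ^ m) (hD : M.testBit η = false)
    (hζ : ζ < 2 ^ m) (hH : M.testBit ζ = true) : massK m M ct (2 ^ t) η ζ = get3 ct η ζ t := by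
  rw [massK_eq_sum' hf (2 ^ t) hη hD hζ hH]
  have : ∀ t' ∈ Finset.range (2 ^ m), (if (2 ^ t).testBit t' = true then get3 ct η ζ t' else 0) = if t = t' then get3 ct η ζ t' else 0 := by
    intro t' _; rw [Nat.testBit_two_pow]; by_cases h : t = t' <;> simp [h]
  rw [Finset.sum_congr rfl this, Finset.sum_ite_eq]
  rw [if_pos (Finset.mem_range.2 ht)]

/-- **Capacity rows are sound**: if the digit test of the row at `t = code T` passes, then `σ(T) ≤ (2 − θ)·w(T)`. [this work] -/
theorem capacity_of_rowOK {σ M : ℕ} {ct : Tab} {P : Set (Set (Fin m))} (hPM : ∀ x, x < 2 ^ m → (M.testBit x = true ↔ pt m x ∈ P))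
    (hf : TabFacts m M ct) (hσ : 0 < σ) (hbnd : BND m * 8 ^ m < 2 ^ (σ - 1)) (q : Fin m → unitInterval) (T : Set (Fin m))
    (hrow : rowOK (offT σ m) (offT σ m).toNat (aZ σ m M ct (prodTab σ m) (krT σ m (fullN m)) (krT σ m (cpl m M)) (code T)) = true) :
    sg m M ct q T ≤ (2 - pr q P) * bernoulliWeight q T := by
  rw [aZ_eq_cubicZ] at hrow
  have hB : (∑ j, |sA m M ct (code T) j|) * 8 ^ m < 2 ^ (σ - 1) := by
    have h1 := abs_sA_le hf (code T)
    have h2 : (BND m : ℤ) * 8 ^ m < 2 ^ (σ - 1) := by exact_mod_cast hbnd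
    nlinarith [h1, show (0:ℤ) < 8 ^ m from by positivity]
  have hF := cubicForm_nonneg_of_rowOK (sA m M ct (code T)) (a1 m M) (a2 m) (a3 m (code T)) hσ hB hrow (inCube_xq q)
  -- evaluate the cubic form
  unfold cubicForm at hF
  rw [Fintype.sum_sum_type, Fin.sum_univ_two, Fintype.sum_prod_type] at hF
  simp only [sA, a1, a2, a3, if_true, show (1 : Fin 2) ≠ 0 from by decide, if_false] at hF
  have hML : ∀ T' : ℕ, ML (fun g => ((tabZ m T' g : ℤ) : ℝ)) (xq q) = mlM m T' (xq q) := fun T' => rfl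
  simp only [hML, show mlM m (fullN m) (xq q) = 1 from ML_fullN m (xq q)] at hF
  have hw : mlM m (2 ^ code T) (xq q) = bernoulliWeight q T := by
    rw [← bernoulliWeight_pt_eq_mlM q (code_lt T), pt_code]
  have hD : mlM m (cpl m M) (xq q) = pr q Pᶜ := by
    rw [pr_eq_mlM]; exact (mlM_congr (tabR_encA_eq (cpl_spec hPM)) _).symm
  have hθ : 2 - pr q P = 1 + pr q Pᶜ := by rw [pr_compl]; ring
  -- the `(η, ζ)` terms are `−DEN·σ(T)`
  have hsg : (∑ η : Fin (2 ^ m), ∑ ζ : Fin (2 ^ m),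
      ((if M.testBit (η : ℕ) = false ∧ M.testBit (ζ : ℕ) = true then -massK m M ct (2 ^ code T) η ζ else 0 : ℤ) : ℝ) *
        (mlM m (2 ^ (η : ℕ)) (xq q) * mlM m (2 ^ (ζ : ℕ)) (xq q) * 1)) = -((DEN : ℝ) * sg m M ct q T) := by
    rw [DEN_mul_sg, ← Finset.sum_neg_distrib]
    refine Finset.sum_congr rfl fun η _ => ?_
    rw [← Finset.sum_neg_distrib]
    refine Finset.sum_congr rfl fun ζ _ => ?_
    split_ifs with hc
    · rw [massK_pow hf (code_lt T) η.2 hc.1 ζ.2 hc.2]; push_cast; ring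
    · simp
  rw [hsg, hw, hD] at hF
  simp only [Int.cast_natCast] at hF
  rw [hθ]
  have hDEN := DEN_pos
  have hkey : (DEN : ℝ) * sg m M ct q T ≤ (DEN : ℝ) * ((1 + pr q Pᶜ) * bernoulliWeight q T) := by nlinarith [hF]
  exact le_of_mul_le_mul_left hkey hDEN

/-! #### Transport rows (TC) -/

/-- Index type of the (TC) rows: eight head terms and the `(η, ζ)` terms. [this work] -/
abbrev JT (m : ℕ) := Fin 8 ⊕ (Fin (2 ^ m) × Fin (2 ^ m))

/-- Signs/coefficients of a (TC) row. [this work] -/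
def sT (m M : ℕ) (ct : Tab) (K : ℕ) : JT m → ℤ
  | Sum.inl j => ![(DEN : ℤ), DEN, -DEN, -DEN, -DEN, -DEN, DEN, DEN] j
  | Sum.inr p => if M.testBit p.1 = false ∧ M.testBit p.2 = true then -massK m M ct K p.1 p.2 else 0

/-- First tables of a (TC) row. [this work] -/
def u1 (m M X Z : ℕ) : JT m → ℕ
  | Sum.inl j => ![fullN m, cpl m M, fullN m, cpl m M, fullN m, cpl m M, X, Z] j
  | Sum.inr p => 2 ^ (p.1 : ℕ)

/-- Second tables of a (TC) row. [this work] -/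
def u2 (m M X Z : ℕ) : JT m → ℕ
  | Sum.inl j => ![fullN m, fullN m, X, X, fullN m, fullN m, cpl m M &&& Z, cpl m M &&& X] j
  | Sum.inr p => 2 ^ (p.2 : ℕ)

/-- Third tables of a (TC) row. [this work] -/
def u3 (m M X Z : ℕ) : JT m → ℕ
  | Sum.inl j => ![X &&& Z, X &&& Z, Z, Z, cpl m M &&& (X &&& Z), cpl m M &&& (X &&& Z), fullN m, fullN m] j
  | Sum.inr _ => fullN m

/-- The `(η, ζ)` part of a certificate number. [this work] -/
theorem inr_sum_eq (σ M : ℕ) (ct : Tab) (K : ℕ) :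
    (∑ η : Fin (2 ^ m), ∑ ζ : Fin (2 ^ m),
      (if M.testBit (η : ℕ) = false ∧ M.testBit (ζ : ℕ) = true then -massK m M ct K η ζ else 0) *
        ((krT σ m (2 ^ (η : ℕ)) : ℤ) * (krT σ m (2 ^ (ζ : ℕ)) : ℤ) * (krT σ m (fullN m) : ℤ))) = -rhoZ m M ct (prodTab σ m) K := by
  rw [rhoZ_eq, ← Finset.sum_neg_distrib]
  rw [Fin.sum_univ_eq_sum_range (fun η => ∑ ζ : Fin (2 ^ m),
      (if M.testBit η = false ∧ M.testBit (ζ : ℕ) = true then -massK m M ct K η ζ else 0) *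
        ((krT σ m (2 ^ η) : ℤ) * (krT σ m (2 ^ (ζ : ℕ)) : ℤ) * (krT σ m (fullN m) : ℤ))) (2 ^ m)]
  refine Finset.sum_congr rfl fun η _ => ?_
  rw [← Finset.sum_neg_distrib, Fin.sum_univ_eq_sum_range (fun ζ =>
      (if M.testBit η = false ∧ M.testBit ζ = true then -massK m M ct K η ζ else 0) *
        ((krT σ m (2 ^ η) : ℤ) * (krT σ m (2 ^ ζ) : ℤ) * (krT σ m (fullN m) : ℤ))) (2 ^ m)]
  refine Finset.sum_congr rfl fun ζ _ => ?_
  split_ifs <;> ring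

/-- The certificate number of a (TC) row is the `cubicZ` of its term family. [this work] -/
theorem tcZ_eq_cubicZ (σ M : ℕ) (ct : Tab) (X Z : ℕ) :
    tcZ σ m M ct (prodTab σ m) (krT σ m (fullN m)) (krT σ m (cpl m M)) X Z =
      cubicZ (2 ^ σ) (sT m M ct (X &&& Z)) (fun j => tabZ m (u1 m M X Z j)) (fun j => tabZ m (u2 m M X Z j))
        (fun j => tabZ m (u3 m M X Z j)) := by
  unfold tcZ cubicZ
  rw [Fintype.sum_sum_type, Fintype.sum_prod_type]
  simp only [sT, u1, u2, u3, Fin.sum_univ_eight, Matrix.cons_val_zero, Matrix.cons_val_one, Matrix.cons_val, ← krT_eq]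
  rw [inr_sum_eq]
  ring

/-- The coefficient budget of a (TC) row. [this work] -/
theorem abs_sT_le {M : ℕ} {ct : Tab} (hf : TabFacts m M ct) (K : ℕ) : (∑ j, |sT m M ct K j|) ≤ (BND m : ℤ) := by
  rw [Fintype.sum_sum_type, Fintype.sum_prod_type]
  have h1 : ∀ η ζ : Fin (2 ^ m), |sT m M ct K (Sum.inr (η, ζ))| ≤ DEN := by
    intro η ζ
    simp only [sT]
    split_ifs with hc
    · rw [abs_neg]
      have hb := massK_bounds hf K η.2 hc.1 ζ.2 hc.2
      rw [abs_of_nonneg hb.1]; exact hb.2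
    · simp [DEN]
  have h2 : (∑ η : Fin (2 ^ m), ∑ ζ : Fin (2 ^ m), |sT m M ct K (Sum.inr (η, ζ))|) ≤ (2 ^ m * (2 ^ m * DEN) : ℤ) := by
    calc (∑ η : Fin (2 ^ m), ∑ ζ : Fin (2 ^ m), |sT m M ct K (Sum.inr (η, ζ))|)
        ≤ ∑ η : Fin (2 ^ m), ∑ ζ : Fin (2 ^ m), (DEN : ℤ) := Finset.sum_le_sum fun η _ => Finset.sum_le_sum fun ζ _ => h1 η ζ
      _ = 2 ^ m * (2 ^ m * DEN) := by simp
  have h0 : (∑ j : Fin 8, |sT m M ct K (Sum.inl j)|) = 8 * DEN := by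
    simp only [sT, Fin.sum_univ_eight, Matrix.cons_val_zero, Matrix.cons_val_one, Matrix.cons_val, abs_neg,
      abs_of_nonneg (show (0 : ℤ) ≤ DEN from by simp [DEN])]
    ring
  rw [h0]
  have h4 : (4 : ℤ) ^ m = 2 ^ m * 2 ^ m := by rw [← mul_pow]; norm_num
  have h5 : (BND m : ℤ) = DEN * (8 + 2 ^ m * 2 ^ m) := by unfold BND; push_cast; rw [h4]
  rw [h5]
  nlinarith [h2, show (0 : ℤ) ≤ DEN from by simp [DEN], show (0:ℤ) ≤ 2 ^ m * 2 ^ m from by positivity]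

/-- The right-hand side of the transport condition (TC) of `SahiTransportCert.TransportCert`. [this work] -/
def tcR {k : ℕ} (q : Fin k → unitInterval) (Hk 𝒳 𝒵 : Set (Set (Fin k))) : ℝ :=
  (2 - pr q Hk) * (pr q (𝒳 ∩ 𝒵) - pr q 𝒳 * pr q 𝒵 - pr q (Hkᶜ ∩ (𝒳 ∩ 𝒵)))
    + pr q 𝒳 * pr q (Hkᶜ ∩ 𝒵) + pr q 𝒵 * pr q (Hkᶜ ∩ 𝒳)

/-- `tcR` is symmetric. [this work] -/
theorem tcR_comm {k : ℕ} (q : Fin k → unitInterval) (Hk 𝒳 𝒵 : Set (Set (Fin k))) : tcR q Hk 𝒳 𝒵 = tcR q Hk 𝒵 𝒳 := by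
  unfold tcR; rw [Set.inter_comm 𝒳 𝒵]; ring

/-- **(TC) rows are sound**: if the digit test of the row at `(encA 𝒳, encA 𝒵)` passes, then `Σ_T σ(T)·1_{𝒳∩𝒵}(T) ≤ tcR`. [this work] -/
theorem tc_of_rowOK {σ M : ℕ} {ct : Tab} {P : Set (Set (Fin m))} (hPM : ∀ x, x < 2 ^ m → (M.testBit x = true ↔ pt m x ∈ P))
    (hf : TabFacts m M ct) (hσ : 0 < σ) (hbnd : BND m * 8 ^ m < 2 ^ (σ - 1)) (q : Fin m → unitInterval) (𝒳 𝒵 : Set (Set (Fin m)))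
    (hrow : rowOK (offT σ m) (offT σ m).toNat
      (tcZ σ m M ct (prodTab σ m) (krT σ m (fullN m)) (krT σ m (cpl m M)) (encA m 𝒳) (encA m 𝒵)) = true) :
    ∑ T, sg m M ct q T * ind (𝒳 ∩ 𝒵) T ≤ tcR q P 𝒳 𝒵 := by
  set X := encA m 𝒳 with hX
  set Z := encA m 𝒵 with hZ
  rw [tcZ_eq_cubicZ] at hrow
  have hB : (∑ j, |sT m M ct (X &&& Z) j|) * 8 ^ m < 2 ^ (σ - 1) := by
    have h1 := abs_sT_le hf (X &&& Z)
    have h2 : (BND m : ℤ) * 8 ^ m < 2 ^ (σ - 1) := by exact_mod_cast hbnd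
    nlinarith [h1, show (0:ℤ) < 8 ^ m from by positivity]
  have hF := cubicForm_nonneg_of_rowOK (sT m M ct (X &&& Z)) (u1 m M X Z) (u2 m M X Z) (u3 m M X Z) hσ hB hrow (inCube_xq q)
  unfold cubicForm at hF
  rw [Fintype.sum_sum_type, Fintype.sum_prod_type] at hF
  simp only [sT, u1, u2, u3, Fin.sum_univ_eight, Matrix.cons_val_zero, Matrix.cons_val_one, Matrix.cons_val] at hF
  have hML : ∀ T' : ℕ, ML (fun g => ((tabZ m T' g : ℤ) : ℝ)) (xq q) = mlM m T' (xq q) := fun T' => rfl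
  simp only [hML, show mlM m (fullN m) (xq q) = 1 from ML_fullN m (xq q)] at hF
  -- dictionary
  have hD : mlM m (cpl m M) (xq q) = pr q Pᶜ := by
    rw [pr_eq_mlM]; exact (mlM_congr (tabR_encA_eq (cpl_spec hPM)) _).symm
  have hθ : 2 - pr q P = 1 + pr q Pᶜ := by rw [pr_compl]; ring
  have hKt : tabR m (encA m (𝒳 ∩ 𝒵)) = tabR m (X &&& Z) := by rw [hX, hZ]; exact tabR_encA_inter 𝒳 𝒵
  have hK : mlM m (X &&& Z) (xq q) = pr q (𝒳 ∩ 𝒵) := by rw [pr_eq_mlM]; exact (mlM_congr hKt _).symm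
  have hXp : mlM m X (xq q) = pr q 𝒳 := by rw [pr_eq_mlM]
  have hZp : mlM m Z (xq q) = pr q 𝒵 := by rw [pr_eq_mlM]
  have hDK : mlM m (cpl m M &&& (X &&& Z)) (xq q) = pr q (Pᶜ ∩ (𝒳 ∩ 𝒵)) := by
    rw [pr_eq_mlM]; refine mlM_congr ?_ _
    rw [(tabR_encA_inter_eq hPM (𝒳 ∩ 𝒵)).2, tabR_land m (cpl m M) (encA m (𝒳 ∩ 𝒵)), hKt, ← tabR_land]
  have hDZ : mlM m (cpl m M &&& Z) (xq q) = pr q (Pᶜ ∩ 𝒵) := by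
    rw [pr_eq_mlM]; exact (mlM_congr (tabR_encA_inter_eq hPM 𝒵).2 _).symm
  have hDX : mlM m (cpl m M &&& X) (xq q) = pr q (Pᶜ ∩ 𝒳) := by
    rw [pr_eq_mlM]; exact (mlM_congr (tabR_encA_inter_eq hPM 𝒳).2 _).symm
  -- the `(η, ζ)` terms are `−DEN·Σ σ·1_{𝒳∩𝒵}`
  have hbits : ∀ t, t < 2 ^ m → ((X &&& Z).testBit t = true ↔ (encA m (𝒳 ∩ 𝒵)).testBit t = true) := by
    intro t ht
    rw [hX, hZ, Nat.testBit_land, Bool.and_eq_true, testBit_encA, testBit_encA, testBit_encA]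
    simp [ht, Set.mem_inter_iff]
  have hsg : (∑ η : Fin (2 ^ m), ∑ ζ : Fin (2 ^ m),
      ((if M.testBit (η : ℕ) = false ∧ M.testBit (ζ : ℕ) = true then -massK m M ct (X &&& Z) η ζ else 0 : ℤ) : ℝ) *
        (mlM m (2 ^ (η : ℕ)) (xq q) * mlM m (2 ^ (ζ : ℕ)) (xq q) * 1)) = -((DEN : ℝ) * ∑ T, sg m M ct q T * ind (𝒳 ∩ 𝒵) T) := by
    rw [sum_sg_mul_ind, ← Finset.sum_neg_distrib]
    rw [Fin.sum_univ_eq_sum_range (fun η => ∑ ζ : Fin (2 ^ m),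
      ((if M.testBit η = false ∧ M.testBit (ζ : ℕ) = true then -massK m M ct (X &&& Z) η ζ else 0 : ℤ) : ℝ) *
        (mlM m (2 ^ η) (xq q) * mlM m (2 ^ (ζ : ℕ)) (xq q) * 1)) (2 ^ m)]
    refine Finset.sum_congr rfl fun η hη => ?_
    rw [← Finset.sum_neg_distrib, Fin.sum_univ_eq_sum_range (fun ζ =>
      ((if M.testBit η = false ∧ M.testBit ζ = true then -massK m M ct (X &&& Z) η ζ else 0 : ℤ) : ℝ) *
        (mlM m (2 ^ η) (xq q) * mlM m (2 ^ ζ) (xq q) * 1)) (2 ^ m)]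
    refine Finset.sum_congr rfl fun ζ hζ => ?_
    by_cases hc : M.testBit η = false ∧ M.testBit ζ = true
    · rw [if_pos hc, if_pos hc, massK_eq_sum' hf (X &&& Z) (Finset.mem_range.1 hη) hc.1 (Finset.mem_range.1 hζ) hc.2]
      have : (∑ t ∈ Finset.range (2 ^ m), if (encA m (𝒳 ∩ 𝒵)).testBit t = true then (get3 ct η ζ t : ℝ) else 0) =
          ((∑ t ∈ Finset.range (2 ^ m), if (X &&& Z).testBit t = true then get3 ct η ζ t else 0 : ℤ) : ℝ) := by
        push_cast
        refine Finset.sum_congr rfl fun t ht => ?_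
        by_cases hb : (X &&& Z).testBit t = true
        · rw [if_pos hb, if_pos ((hbits t (Finset.mem_range.1 ht)).1 hb)]
        · rw [if_neg hb, if_neg (fun h' => hb ((hbits t (Finset.mem_range.1 ht)).2 h'))]
      rw [this]; push_cast; ring
    · rw [if_neg hc, if_neg hc]; simp
  rw [hsg, hK, hXp, hZp, hDK, hDZ, hDX, hD] at hF
  simp only [Int.cast_natCast, Int.cast_neg] at hF
  unfold tcR
  rw [hθ]
  have hDEN := DEN_pos
  have hkey : (DEN : ℝ) * ∑ T, sg m M ct q T * ind (𝒳 ∩ 𝒵) T ≤ (DEN : ℝ) * ((1 + pr q Pᶜ) * (pr q (𝒳 ∩ 𝒵) - pr q 𝒳 * pr q 𝒵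
      - pr q (Pᶜ ∩ (𝒳 ∩ 𝒵))) + pr q 𝒳 * pr q (Pᶜ ∩ 𝒵) + pr q 𝒵 * pr q (Pᶜ ∩ 𝒳)) := by nlinarith [hF]
  exact le_of_mul_le_mul_left hkey hDEN


end Summit.CriticalPhenomena.PercolationContinuityZ3.Theorems.SahiTransportJR
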